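import Summits.Ventures.CertifiedQuantumChemistry.Rows.SingletRelaxationRowEquivalence
import HarnessLib

/-!
# Ventures/CertifiedQuantumChemistry — Rows/SingletSpinFreeRow.lean: the printed singlet programme is
# the spin-orbital `N`-programme plus ONE spin-free row `⟨Ŝ²⟩ = 0`

HONEST FRAMING (verbatim): certified bounds for a stated model Hamiltonian in a stated basis; not a
claim about the real molecule beyond that model.

Seat rdm-A (gen 60), ROWS file (theorems only; no `def`, no notation; zero compute; nothing landed is
touched). The typer's singlet-restricted programme `IsDQGFeasibleSinglet n` is `DQG` at `N = 2n` in the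
`(n,n)` `S_z`-sector (selection rule of `γ`, spin traces `Tr γ_αα = Tr γ_ββ = n`, block traces — cf.
Mazziotti 2007 §II.F (87)–(90)) PLUS the `S`-representability row (98) `Σ_{xy} Γ_{(xα,yβ),(yα,xβ)} = n`,
which — when the "basis functions for the 2-RDM are only eigenfunctions of `Ŝ_z`" — "must be enforced
in addition to the 2-positivity conditions" (ibid. §II.F.1). THIS FILE: that feasible set is cut out of
the plain spin-orbital programme `IsDQGFeasible (n + n)` (no spin bookkeeping at all) by ONE linear row
that does not see the spin labels,
  `Y(Γ) := Σ_{σ,τ} Σ_{p,q} Γ_{(pσ,qτ),(qσ,pτ)} = 2n(2 − n)`,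
the spin-summed exchange trace (`⟨Ŝ²⟩ = −N(N−4)/4 − Y/2` on `N`-representable pairs — Löwdin's
two-matrix formula, cf. (96)–(98) and Alcoba's eq. (75) ibid.; at `N = 2n` the row reads `⟨Ŝ²⟩ = 0`).
* §1 `sum_gMap_upDown_nonneg`, `sum_gMap_downUp_nonneg` — `G(γ,Γ) ⪰ 0` makes the `⟨Ŝ_+Ŝ_−⟩`- and
  `⟨Ŝ_−Ŝ_+⟩`-forms (indicators of the members `(rα,rβ)`, `(rβ,rα)`) non-negative; `szForm_eq` writes
  the form on `z = Σ_r e_{(rα,rα)} − e_{(rβ,rβ)}` (`⟨(N̂_α−N̂_β)²⟩`) in entries; `szKernel_row` its rows.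
* §2 **`four_spinSq_eq`** — ON THE `N`-PROGRAMME `2⟨Ŝ_+Ŝ_−⟩ + 2⟨Ŝ_−Ŝ_+⟩ + z†Gz` (`= 4⟨Ŝ²⟩`) is the
  LINEAR functional `4N − N² − 2Y(Γ)` (trace row, contraction row (16), antisymmetry); hence
  `two_mul_exchangeTrace_le`: `2Y(Γ) ≤ 4N − N²` on `IsDQGFeasible N` (`⟨Ŝ²⟩ ≥ 0` FOLLOWS from `G ⪰ 0`).
* §3 **`isDQGFeasibleSinglet_of_spinFreeRow`** — `IsDQGFeasible (n+n)` + `Y(Γ) = 2n(2−n)` IMPLY the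
  printed singlet rows: the three forms vanish, giving the spin traces and row (98), and the kernel
  vector `G z = 0`, whose rows — read at `(pσ,qτ)` and, conjugated, at `(qτ,pσ)` — give the `S_z`
  SELECTION RULE and, solved against row (16), the spin-resolved contraction rows, i.e. the block traces
  (87)–(90) (`isDQGFeasibleSector_of_spinContract`); `exchangeTrace_of_isDQGFeasibleSinglet` (converse).
* §4 **`isDQGFeasibleSinglet_iff_spinFreeRow`**, **`isDQGT1T2PrimeFeasibleSinglet_iff_spinFreeRow`**
  (the feasible SETS coincide, DQG and PQGT1T2′ rungs); `pqgSingletEnergy_eq_sInf_spinFreeRow`;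
  `le_minEnergyOn_singlet_of_forall_spinFreeRow` (the singlet lower bound in this form).
Reading for the cell (FORMAT-qcl1 §9 `su2`: "statement = N-sector"): the `S_z` bookkeeping of an `s2v`
instance (zero pattern, E1–E4) is REDUNDANT given `G ⪰ 0` and the one spin-free row; neither `Y` nor the
`N`-programme sees the spin basis (spin-rotation covariance / SU(2) adaptation: NOT here, next file).
Everything is PROVED (0 sorry, standard axioms); no definitions, no named facts; nothing asserts a bound
about any model; no claim node, no hint / row depends on it.
References: D. A. Mazziotti, in *Reduced-Density-Matrix Mechanics*, Adv. Chem. Phys. 134 (Wiley 2007)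
ch. 3 §II.F eqs. (87)–(90), §II.F.1 eqs. (96)–(98) (held copy PDF pp. 48, 50); D. R. Alcoba, ibid.
eq. (75) (PDF p. 229); M. Nakata et al., J. Chem. Phys. 128 (2008) 164113 §II.A–C.
Tree (REUSED): `IsDQGFeasible`, `gMap`, `IsDQGFeasibleSinglet`, `IsDQGT1T2PrimeFeasibleSinglet`,
`pqgSingletEnergy`, `le_minEnergyOn_singlet_of_forall_isDQGFeasibleSinglet` (typer);
`isDQGFeasibleSector_of_spinContract`, `sum_gMap_apply_diag` (`Rows/GMatrixRelaxationKernel`),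
`sum_gMap_upDown_eq`, `sum_gMap_downUp_eq`, `sum_exchange_downUp_eq`
(`Rows/MaximalSpinProjectionRelaxationKernel`), `sum_orb_eq_sum_sum` (QuantumLattice). Mathlib:
`Matrix.PosSemidef.dotProduct_mulVec_nonneg` / `dotProduct_mulVec_zero_iff`, `Matrix.IsHermitian.apply`.
-/

noncomputable section

namespace Summit.Ventures.CertifiedQuantumChemistry

open Matrix Finset
open Literature.MathematicalPhysics.QuantumLattice Literature.MathematicalPhysics.QuantumChemistry
open scoped ComplexOrder

variable {Λ : Type*} [LinearOrder Λ] [Fintype Λ] {N n : ℕ}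
  {γ : Matrix (Orb Λ) (Orb Λ) ℂ} {Γ : Matrix (Orb Λ × Orb Λ) (Orb Λ × Orb Λ) ℂ}

/-- `(G v_f)_m = Σ_r G_{m, f r}` for the indicator `v_f` of a family `f` of pair indices. -/
private theorem mulVec_indicator_apply (G : Matrix (Orb Λ × Orb Λ) (Orb Λ × Orb Λ) ℂ)
    (f : Λ → Orb Λ × Orb Λ) (m : Orb Λ × Orb Λ) :
    (G *ᵥ fun j => ∑ r : Λ, if j = f r then (1 : ℂ) else 0) m = ∑ r : Λ, G m (f r) := by
  simp only [mulVec, dotProduct, Finset.mul_sum, mul_ite, mul_one, mul_zero]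
  rw [Finset.sum_comm]
  simp only [Finset.sum_ite_eq', Finset.mem_univ, if_true]

/-- `v_f ⬝ w = Σ_r w (f r)`. -/
private theorem indicator_dotProduct (f : Λ → Orb Λ × Orb Λ) (w : Orb Λ × Orb Λ → ℂ) :
    (fun j : Orb Λ × Orb Λ => ∑ r : Λ, if j = f r then (1 : ℂ) else 0) ⬝ᵥ w = ∑ r : Λ, w (f r) := by
  simp only [dotProduct, Finset.sum_mul, ite_mul, one_mul, zero_mul]
  rw [Finset.sum_comm]
  simp only [Finset.sum_ite_eq', Finset.mem_univ, if_true]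

/-- The indicator `v_f` is real: `star v_f = v_f`. -/
private theorem star_indicator (f : Λ → Orb Λ × Orb Λ) :
    star (fun j : Orb Λ × Orb Λ => ∑ r : Λ, if j = f r then (1 : ℂ) else 0) =
      fun j => ∑ r : Λ, if j = f r then (1 : ℂ) else 0 := by
  funext j
  simp only [Pi.star_apply, star_sum, apply_ite star, star_one, star_zero]

/-- The form of `G` between two indicators: `v_f† G v_g = Σ_{pq} G_{f p, g q}`. -/
private theorem indicator_form (G : Matrix (Orb Λ × Orb Λ) (Orb Λ × Orb Λ) ℂ)
    (f g : Λ → Orb Λ × Orb Λ) :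
    (fun j : Orb Λ × Orb Λ => ∑ r : Λ, if j = f r then (1 : ℂ) else 0) ⬝ᵥ
        (G *ᵥ fun j => ∑ r : Λ, if j = g r then (1 : ℂ) else 0) = ∑ p : Λ, ∑ q : Λ, G (f p) (g q) := by
  rw [indicator_dotProduct]
  exact Finset.sum_congr rfl fun p _ => mulVec_indicator_apply G g (f p)

/-! ### §1 The three spin forms of the `G` matrix are non-negative on `G ⪰ 0` -/

/-- **`⟨Ŝ_+Ŝ_−⟩ ≥ 0` at the relaxation level**: `G(γ, Γ) ⪰ 0` gives
`0 ≤ Tr γ_αα − Σ_{xy} Γ_{(xα,yβ),(yα,xβ)}` (the form of `G` on the indicator of the members `(rα, rβ)`). -/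
theorem sum_gMap_upDown_nonneg (hG : (gMap γ Γ).PosSemidef) :
    0 ≤ ∑ x : Λ, γ (orb x 0) (orb x 0) - ∑ x : Λ, ∑ y : Λ, Γ (orb x 0, orb y 1) (orb y 0, orb x 1) := by
  have h := hG.dotProduct_mulVec_nonneg fun j => ∑ r : Λ, if j = (orb r 0, orb r 1) then (1 : ℂ) else 0
  rwa [star_indicator, indicator_form, sum_gMap_upDown_eq] at h

/-- **`⟨Ŝ_−Ŝ_+⟩ ≥ 0` at the relaxation level**: `0 ≤ Tr γ_ββ − Σ_{pq} Γ_{(pβ,qα),(qβ,pα)}`. -/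
theorem sum_gMap_downUp_nonneg (hG : (gMap γ Γ).PosSemidef) :
    0 ≤ ∑ x : Λ, γ (orb x 1) (orb x 1) - ∑ p : Λ, ∑ q : Λ, Γ (orb p 1, orb q 0) (orb q 1, orb p 0) := by
  have h := hG.dotProduct_mulVec_nonneg fun j => ∑ r : Λ, if j = (orb r 1, orb r 0) then (1 : ℂ) else 0
  rwa [star_indicator, indicator_form, sum_gMap_downUp_eq] at h

/-- **`⟨(N̂_α − N̂_β)²⟩ ≥ 0` at the relaxation level**: the form of `G(γ,Γ) ⪰ 0` on
`z = Σ_r e_{(rα,rα)} − e_{(rβ,rβ)}`. -/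
theorem szForm_nonneg (hG : (gMap γ Γ).PosSemidef) :
    0 ≤ star ((fun j : Orb Λ × Orb Λ => ∑ r : Λ, if j = (orb r 0, orb r 0) then (1 : ℂ) else 0) -
          fun j => ∑ r : Λ, if j = (orb r 1, orb r 1) then (1 : ℂ) else 0) ⬝ᵥ
        (gMap γ Γ *ᵥ ((fun j : Orb Λ × Orb Λ => ∑ r : Λ, if j = (orb r 0, orb r 0) then (1 : ℂ) else 0) -
          fun j => ∑ r : Λ, if j = (orb r 1, orb r 1) then (1 : ℂ) else 0)) :=
  hG.dotProduct_mulVec_nonneg _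

/-- A diagonal double sum of `G(γ, Γ)` over members `(xσ,xσ)`, `(yτ,yτ)` in `(γ, Γ)` entries. -/
private theorem sum_sum_gMap_diag (γ : Matrix (Orb Λ) (Orb Λ) ℂ)
    (Γ : Matrix (Orb Λ × Orb Λ) (Orb Λ × Orb Λ) ℂ) (σ τ : Fin 2) :
    ∑ x : Λ, ∑ y : Λ, gMap γ Γ (orb x σ, orb x σ) (orb y τ, orb y τ) =
      (if σ = τ then ∑ x : Λ, γ (orb x σ) (orb x σ) else 0) -
        ∑ x : Λ, ∑ y : Λ, Γ (orb x σ, orb y τ) (orb y τ, orb x σ) := by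
  simp only [sum_gMap_apply_diag, Finset.sum_sub_distrib]
  split_ifs <;> simp

/-- **The `S_z²`-form in entries**: `z† G(γ,Γ) z = Tr γ_αα + Tr γ_ββ − Σ Γ_{(xα,yα),(yα,xα)} −
Σ Γ_{(xβ,yβ),(yβ,xβ)} + Σ Γ_{(xα,yβ),(yβ,xα)} + Σ Γ_{(xβ,yα),(yα,xβ)}` (for ANY pair). -/
theorem szForm_eq (γ : Matrix (Orb Λ) (Orb Λ) ℂ) (Γ : Matrix (Orb Λ × Orb Λ) (Orb Λ × Orb Λ) ℂ) :
    star ((fun j : Orb Λ × Orb Λ => ∑ r : Λ, if j = (orb r 0, orb r 0) then (1 : ℂ) else 0) -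
          fun j => ∑ r : Λ, if j = (orb r 1, orb r 1) then (1 : ℂ) else 0) ⬝ᵥ
        (gMap γ Γ *ᵥ ((fun j : Orb Λ × Orb Λ => ∑ r : Λ, if j = (orb r 0, orb r 0) then (1 : ℂ) else 0) -
          fun j => ∑ r : Λ, if j = (orb r 1, orb r 1) then (1 : ℂ) else 0)) =
      ∑ x : Λ, γ (orb x 0) (orb x 0) + ∑ x : Λ, γ (orb x 1) (orb x 1) -
        ∑ x : Λ, ∑ y : Λ, Γ (orb x 0, orb y 0) (orb y 0, orb x 0) -
        ∑ x : Λ, ∑ y : Λ, Γ (orb x 1, orb y 1) (orb y 1, orb x 1) +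
        ∑ x : Λ, ∑ y : Λ, Γ (orb x 0, orb y 1) (orb y 1, orb x 0) +
        ∑ x : Λ, ∑ y : Λ, Γ (orb x 1, orb y 0) (orb y 0, orb x 1) := by
  rw [star_sub, star_indicator, star_indicator, Matrix.mulVec_sub, sub_dotProduct, dotProduct_sub,
    dotProduct_sub, indicator_form, indicator_form, indicator_form, indicator_form, sum_sum_gMap_diag,
    sum_sum_gMap_diag, sum_sum_gMap_diag, sum_sum_gMap_diag]
  simp only [if_true, show ((0 : Fin 2) = 1) = False from by decide,
    show ((1 : Fin 2) = 0) = False from by decide, if_false]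
  ring

/-- The kernel rows of `z`: if `G(γ,Γ) z = 0` then for every row index `(P, qτ)`,
`(δ_{τα} − δ_{τβ}) γ_{P,qτ} + Σ_x Γ_{(P,xα),(qτ,xα)} − Σ_x Γ_{(P,xβ),(qτ,xβ)} = 0`. -/
theorem szKernel_row (hsnd : ∀ p k l, Γ p (l, k) = -Γ p (k, l))
    (hker : gMap γ Γ *ᵥ ((fun j : Orb Λ × Orb Λ => ∑ r : Λ, if j = (orb r 0, orb r 0) then (1 : ℂ) else 0) -
          fun j => ∑ r : Λ, if j = (orb r 1, orb r 1) then (1 : ℂ) else 0) = 0)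
    (P : Orb Λ) (q : Λ) (τ : Fin 2) :
    (if τ = 0 then γ P (orb q τ) else 0) - (if τ = 1 then γ P (orb q τ) else 0) +
        ∑ x : Λ, Γ (P, orb x 0) (orb q τ, orb x 0) - ∑ x : Λ, Γ (P, orb x 1) (orb q τ, orb x 1) = 0 := by
  have h0 := congr_fun hker (P, orb q τ)
  rw [Matrix.mulVec_sub, Pi.sub_apply, mulVec_indicator_apply, mulVec_indicator_apply,
    sum_gMap_apply_diag, sum_gMap_apply_diag, Pi.zero_apply] at h0
  have hs : ∀ σ : Fin 2, ∑ x : Λ, Γ (P, orb x σ) (orb x σ, orb q τ) =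
      -∑ x : Λ, Γ (P, orb x σ) (orb q τ, orb x σ) := fun σ => by
    rw [← Finset.sum_neg_distrib]
    exact Finset.sum_congr rfl fun x _ => hsnd _ _ _
  rw [hs 0, hs 1] at h0
  linear_combination h0

/-! ### §2 On the `N`-programme, `4⟨Ŝ²⟩` is the linear functional `4N − N² − 2Y(Γ)` -/

/-- The trace row split by spin: `Tr γ_αα + Tr γ_ββ = N`. -/
theorem trace_up_add_trace_down (h : IsDQGFeasible N γ Γ) :
    ∑ x : Λ, γ (orb x 0) (orb x 0) + ∑ x : Λ, γ (orb x 1) (orb x 1) = N := by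
  rw [← Finset.sum_add_distrib, ← h.trace_one, sum_orb_eq_sum_sum]
  exact Finset.sum_congr rfl fun x _ => (Fin.sum_univ_two fun σ => γ (orb x σ) (orb x σ)).symm

/-- The contraction row (16) split by the spin of the summed index:
`Σ_x Γ_{(P,xα),(Q,xα)} + Σ_x Γ_{(P,xβ),(Q,xβ)} = (N − 1) γ_{PQ}`. -/
theorem contract_up_add_contract_down (h : IsDQGFeasible N γ Γ) (P Q : Orb Λ) :
    ∑ x : Λ, Γ (P, orb x 0) (Q, orb x 0) + ∑ x : Λ, Γ (P, orb x 1) (Q, orb x 1) =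
      ((N : ℂ) - 1) * γ P Q := by
  rw [← Finset.sum_add_distrib, ← h.contract P Q, sum_orb_eq_sum_sum]
  exact Finset.sum_congr rfl fun x _ => (Fin.sum_univ_two fun σ => Γ (P, orb x σ) (Q, orb x σ)).symm

/-- Block traces against the contraction row: `Tr Γ_{σα} + Tr Γ_{σβ} = (N − 1) Tr γ_σσ`. -/
theorem blockTrace_add_blockTrace (h : IsDQGFeasible N γ Γ) (σ : Fin 2) :
    ∑ x : Λ, ∑ y : Λ, Γ (orb x σ, orb y 0) (orb x σ, orb y 0) +
        ∑ x : Λ, ∑ y : Λ, Γ (orb x σ, orb y 1) (orb x σ, orb y 1) =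
      ((N : ℂ) - 1) * ∑ x : Λ, γ (orb x σ) (orb x σ) := by
  rw [← Finset.sum_add_distrib, Finset.mul_sum]
  exact Finset.sum_congr rfl fun x _ => contract_up_add_contract_down h _ _

omit [LinearOrder Λ] in
/-- A "crossed" block sum is minus a block trace (antisymmetry in the column pair). -/
theorem sum_sum_cross_eq_neg (hsnd : ∀ p k l, Γ p (l, k) = -Γ p (k, l)) (σ τ : Fin 2) :
    ∑ x : Λ, ∑ y : Λ, Γ (orb x σ, orb y τ) (orb y τ, orb x σ) =
      -∑ x : Λ, ∑ y : Λ, Γ (orb x σ, orb y τ) (orb x σ, orb y τ) := by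
  simp only [← Finset.sum_neg_distrib]
  exact Finset.sum_congr rfl fun x _ => Finset.sum_congr rfl fun y _ => hsnd _ _ _

/-- **`4⟨Ŝ²⟩` is linear on the `N`-programme.** For every DQG-feasible pair at particle number `N`,
`2·(Tr γ_αα − Σ Γ_{(xα,yβ),(yα,xβ)}) + 2·(Tr γ_ββ − Σ Γ_{(pβ,qα),(qβ,pα)}) + z† G z
= 4N − N² − 2 Y(Γ)`, `Y(Γ) = Σ_{στ} Σ_{pq} Γ_{(pσ,qτ),(qσ,pτ)}` (trace row, contraction row (16),
antisymmetry; Löwdin's `⟨Ŝ²⟩ = −N(N−4)/4 − Y/2` at the level of abstract pairs). -/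
theorem four_spinSq_eq (h : IsDQGFeasible N γ Γ) :
    2 * (∑ x : Λ, γ (orb x 0) (orb x 0) - ∑ x : Λ, ∑ y : Λ, Γ (orb x 0, orb y 1) (orb y 0, orb x 1)) +
      2 * (∑ x : Λ, γ (orb x 1) (orb x 1) - ∑ p : Λ, ∑ q : Λ, Γ (orb p 1, orb q 0) (orb q 1, orb p 0)) +
      star ((fun j : Orb Λ × Orb Λ => ∑ r : Λ, if j = (orb r 0, orb r 0) then (1 : ℂ) else 0) -
          fun j => ∑ r : Λ, if j = (orb r 1, orb r 1) then (1 : ℂ) else 0) ⬝ᵥ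
        (gMap γ Γ *ᵥ ((fun j : Orb Λ × Orb Λ => ∑ r : Λ, if j = (orb r 0, orb r 0) then (1 : ℂ) else 0) -
          fun j => ∑ r : Λ, if j = (orb r 1, orb r 1) then (1 : ℂ) else 0)) =
      4 * (N : ℂ) - (N : ℂ) ^ 2 -
        2 * ∑ σ : Fin 2, ∑ τ : Fin 2, ∑ p : Λ, ∑ q : Λ, Γ (orb p σ, orb q τ) (orb q σ, orb p τ) := by
  have ht := trace_up_add_trace_down h
  have hB0 := blockTrace_add_blockTrace h 0
  have hB1 := blockTrace_add_blockTrace h 1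
  have hY00 := sum_sum_cross_eq_neg h.swap_snd (0 : Fin 2) 0
  have hY11 := sum_sum_cross_eq_neg h.swap_snd (1 : Fin 2) 1
  have hW01 := sum_sum_cross_eq_neg h.swap_snd (0 : Fin 2) 1
  have hW10 := sum_sum_cross_eq_neg h.swap_snd (1 : Fin 2) 0
  rw [szForm_eq]
  simp only [Fin.sum_univ_two]
  linear_combination (4 - (N : ℂ)) * ht - hB0 - hB1 + hY00 + hY11 + hW01 + hW10

/-- **`⟨Ŝ²⟩ ≥ 0` on the `N`-programme**: `2 Y(Γ) ≤ 4N − N²` at every DQG-feasible pair (the three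
forms of §1 are non-negative). -/
theorem two_mul_exchangeTrace_le (h : IsDQGFeasible N γ Γ) :
    2 * ∑ σ : Fin 2, ∑ τ : Fin 2, ∑ p : Λ, ∑ q : Λ, Γ (orb p σ, orb q τ) (orb q σ, orb p τ) ≤
      4 * (N : ℂ) - (N : ℂ) ^ 2 := by
  have hS := four_spinSq_eq h
  have h1 := sum_gMap_upDown_nonneg h.g_psd
  have h2 := sum_gMap_downUp_nonneg h.g_psd
  have h3 := szForm_nonneg h.g_psd
  have h4 : (0 : ℂ) ≤ 2 := zero_le_two
  linear_combination hS + 2 * h1 + 2 * h2 + h3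

/-! ### §3 The `N`-programme plus the one spin-free row implies the printed singlet programme -/

/-- **THE SPIN-FREE ROW FORCES THE SINGLET PROGRAMME.** If `(γ, Γ)` is DQG feasible at `N = 2n` and
`Y(Γ) = Σ_{στ} Σ_{pq} Γ_{(pσ,qτ),(qσ,pτ)} = 2n(2 − n)` (`⟨Ŝ²⟩ = 0`), then it is feasible for the
printed singlet-restricted programme: `S_z` selection rule, `Tr γ_αα = Tr γ_ββ = n`, block traces
(87)–(90) and the `S`-representability row (98). Mazziotti 2007 §II.F–F.1, here DERIVED from `G ⪰ 0`. -/
theorem isDQGFeasibleSinglet_of_spinFreeRow (h : IsDQGFeasible (n + n) γ Γ)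
    (hY : ∑ σ : Fin 2, ∑ τ : Fin 2, ∑ p : Λ, ∑ q : Λ, Γ (orb p σ, orb q τ) (orb q σ, orb p τ) =
      2 * (n : ℂ) * (2 - (n : ℂ))) :
    IsDQGFeasibleSinglet n γ Γ := by
  -- the three non-negative forms sum to `4N − N² − 2Y = 0`, hence each vanishes
  have hsum := four_spinSq_eq h
  rw [hY, Nat.cast_add, show (4 * ((n : ℂ) + n) - ((n : ℂ) + n) ^ 2 - 2 * (2 * (n : ℂ) * (2 - (n : ℂ))))
    = 0 by ring] at hsum
  have h1 := sum_gMap_upDown_nonneg h.g_psd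
  have h2 := sum_gMap_downUp_nonneg h.g_psd
  have h3 := szForm_nonneg h.g_psd
  have h2nn : (0 : ℂ) ≤ 2 := zero_le_two
  obtain ⟨h12, hz⟩ := (add_eq_zero_iff_of_nonneg
    (add_nonneg (mul_nonneg h2nn h1) (mul_nonneg h2nn h2)) h3).1 hsum
  obtain ⟨h1', h2'⟩ := (add_eq_zero_iff_of_nonneg (mul_nonneg h2nn h1) (mul_nonneg h2nn h2)).1 h12
  have hF01 : ∑ x : Λ, γ (orb x 0) (orb x 0) -
      ∑ x : Λ, ∑ y : Λ, Γ (orb x 0, orb y 1) (orb y 0, orb x 1) = 0 :=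
    (mul_eq_zero.1 h1').resolve_left two_ne_zero
  have hF10 : ∑ x : Λ, γ (orb x 1) (orb x 1) -
      ∑ p : Λ, ∑ q : Λ, Γ (orb p 1, orb q 0) (orb q 1, orb p 0) = 0 :=
    (mul_eq_zero.1 h2').resolve_left two_ne_zero
  -- spin traces and row (98)
  have hYx := sum_exchange_downUp_eq (Γ := Γ) h.swap_fst h.swap_snd
  have ht := trace_up_add_trace_down h
  rw [Nat.cast_add] at ht
  have hup : ∑ x : Λ, γ (orb x 0) (orb x 0) = n := by
    linear_combination (1 / 2 : ℂ) * (hF01 - hF10 - hYx + ht)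
  have hdown : ∑ x : Λ, γ (orb x 1) (orb x 1) = n := by
    linear_combination (1 / 2 : ℂ) * (hF10 - hF01 + hYx + ht)
  have h98 : ∑ x : Λ, ∑ y : Λ, Γ (orb x 0, orb y 1) (orb y 0, orb x 1) = n := by
    linear_combination hup - hF01
  -- the kernel vector `z` and its rows
  have hker := (h.g_psd.dotProduct_mulVec_zero_iff _).1 hz
  have hrow := szKernel_row h.swap_snd hker
  have hcon : ∀ P Q : Orb Λ, ∑ x : Λ, Γ (P, orb x 0) (Q, orb x 0) + ∑ x : Λ, Γ (P, orb x 1) (Q, orb x 1) =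
      ((n : ℂ) + n - 1) * γ P Q := fun P Q => by
    rw [← Nat.cast_add]; exact contract_up_add_contract_down h P Q
  have h10 : ((1 : Fin 2) = 0) = False := by decide
  have h01 : ((0 : Fin 2) = 1) = False := by decide
  -- `S_z` selection rule: the `z` rows at `(pσ, qτ)` and, conjugated, at `(qτ, pσ)`, `σ ≠ τ`
  have hsel01 : ∀ p q : Λ, γ (orb p 0) (orb q 1) = 0 := fun p q => by
    have r1 := hrow (orb p 0) q 1
    have r2 := congrArg star (hrow (orb q 1) p 0)
    simp only [star_add, star_sub, star_sum, star_zero, h.herm_one.apply, h.d_psd.1.apply, h10, h01,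
      if_true, if_false] at r1 r2
    linear_combination (1 / 2 : ℂ) * (r2 - r1)
  have hsel10 : ∀ p q : Λ, γ (orb p 1) (orb q 0) = 0 := fun p q => by
    have r1 := hrow (orb p 1) q 0
    have r2 := congrArg star (hrow (orb q 0) p 1)
    simp only [star_add, star_sub, star_sum, star_zero, h.herm_one.apply, h.d_psd.1.apply, h10, h01,
      if_true, if_false] at r1 r2
    linear_combination (1 / 2 : ℂ) * (r1 - r2)
  have hkey : ∀ σ τ : Fin 2, σ ≠ τ → σ = 0 ∧ τ = 1 ∨ σ = 1 ∧ τ = 0 := by decide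
  have hsel : ∀ p q : Λ, ∀ σ τ : Fin 2, σ ≠ τ → γ (orb p σ) (orb q τ) = 0 := by
    intro p q σ τ hστ
    rcases hkey σ τ hστ with ⟨rfl, rfl⟩ | ⟨rfl, rfl⟩
    exacts [hsel01 p q, hsel10 p q]
  -- spin-resolved contraction rows E2, solved from the `z` rows against the contraction row (16)
  have hE2aa : ∀ p q : Λ,
      ∑ y : Λ, Γ (orb p 0, orb y 0) (orb q 0, orb y 0) = ((n : ℂ) - 1) * γ (orb p 0) (orb q 0) := by
    intro p q
    have r := hrow (orb p 0) q 0
    simp only [h01, if_true, if_false] at r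
    linear_combination (1 / 2 : ℂ) * r + (1 / 2 : ℂ) * hcon (orb p 0) (orb q 0)
  have hE2ab : ∀ p q : Λ,
      ∑ y : Λ, Γ (orb p 0, orb y 1) (orb q 0, orb y 1) = (n : ℂ) * γ (orb p 0) (orb q 0) := by
    intro p q
    have r := hrow (orb p 0) q 0
    simp only [h01, if_true, if_false] at r
    linear_combination (-1 / 2 : ℂ) * r + (1 / 2 : ℂ) * hcon (orb p 0) (orb q 0)
  have hE2bb : ∀ p q : Λ,
      ∑ y : Λ, Γ (orb p 1, orb y 1) (orb q 1, orb y 1) = ((n : ℂ) - 1) * γ (orb p 1) (orb q 1) := by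
    intro p q
    have r := hrow (orb p 1) q 1
    simp only [h10, if_true, if_false] at r
    linear_combination (-1 / 2 : ℂ) * r + (1 / 2 : ℂ) * hcon (orb p 1) (orb q 1)
  exact
    { toIsDQGFeasibleSector := isDQGFeasibleSector_of_spinContract h hsel hup hdown hE2aa hE2ab hE2bb
      exchange_sum := h98 }

/-- **The printed singlet rows imply the spin-free row**: `Y(Γ) = −Tr Γ_αα − Tr Γ_ββ + 2·(row 98)
= −2n(n−1) + 2n = 2n(2 − n)` at every singlet-feasible pair. -/
theorem exchangeTrace_of_isDQGFeasibleSinglet (h : IsDQGFeasibleSinglet n γ Γ) :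
    ∑ σ : Fin 2, ∑ τ : Fin 2, ∑ p : Λ, ∑ q : Λ, Γ (orb p σ, orb q τ) (orb q σ, orb p τ) =
      2 * (n : ℂ) * (2 - (n : ℂ)) := by
  have hd := h.dqg
  have hY00 := sum_sum_cross_eq_neg hd.swap_snd (0 : Fin 2) 0
  have hY11 := sum_sum_cross_eq_neg hd.swap_snd (1 : Fin 2) 1
  rw [h.trace_upUp] at hY00
  rw [h.trace_downDown] at hY11
  have hYx := sum_exchange_downUp_eq (Γ := Γ) hd.swap_fst hd.swap_snd
  have h98 := h.exchange_sum
  simp only [Fin.sum_univ_two]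
  linear_combination hY00 + hY11 + hYx + 2 * h98

/-! ### §4 The two feasible sets coincide; the value and the lower bound in spin-free form -/

/-- **THE SINGLET PROGRAMME IN SPIN-ORBITAL FORM (DQG rung).** A pair is feasible for the printed
singlet-restricted `DQG` programme at `N = 2n` (Mazziotti 2007 §II.F.1: `S_z`-sector rows + row (98))
iff it is DQG feasible at `N = 2n` and satisfies the ONE spin-free row
`Σ_{στ} Σ_{pq} Γ_{(pσ,qτ),(qσ,pτ)} = 2n(2 − n)` (`⟨Ŝ²⟩ = 0`). -/
theorem isDQGFeasibleSinglet_iff_spinFreeRow (n : ℕ) (γ : Matrix (Orb Λ) (Orb Λ) ℂ)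
    (Γ : Matrix (Orb Λ × Orb Λ) (Orb Λ × Orb Λ) ℂ) :
    IsDQGFeasibleSinglet n γ Γ ↔
      IsDQGFeasible (n + n) γ Γ ∧
        ∑ σ : Fin 2, ∑ τ : Fin 2, ∑ p : Λ, ∑ q : Λ, Γ (orb p σ, orb q τ) (orb q σ, orb p τ) =
          2 * (n : ℂ) * (2 - (n : ℂ)) :=
  ⟨fun h => ⟨h.dqg, exchangeTrace_of_isDQGFeasibleSinglet h⟩,
    fun h => isDQGFeasibleSinglet_of_spinFreeRow h.1 h.2⟩

/-- **The same at the `PQGT1T2′` rung**: singlet-feasible for the three-index programme iff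
`PQGT1T2′`-feasible at `N = 2n` (`IsDQGT1T2PrimeFeasible`) with the one spin-free row. -/
theorem isDQGT1T2PrimeFeasibleSinglet_iff_spinFreeRow (n : ℕ) (γ : Matrix (Orb Λ) (Orb Λ) ℂ)
    (Γ : Matrix (Orb Λ × Orb Λ) (Orb Λ × Orb Λ) ℂ) :
    IsDQGT1T2PrimeFeasibleSinglet n γ Γ ↔
      IsDQGT1T2PrimeFeasible (n + n) γ Γ ∧
        ∑ σ : Fin 2, ∑ τ : Fin 2, ∑ p : Λ, ∑ q : Λ, Γ (orb p σ, orb q τ) (orb q σ, orb p τ) =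
          2 * (n : ℂ) * (2 - (n : ℂ)) := by
  constructor
  · intro h
    exact ⟨h.toIsDQGT1T2PrimeFeasibleSector.isDQGT1T2PrimeFeasible,
      exchangeTrace_of_isDQGFeasibleSinglet h.toIsDQGFeasibleSinglet⟩
  · rintro ⟨hT, hY⟩
    have hs := isDQGFeasibleSinglet_of_spinFreeRow hT.toIsDQGFeasible hY
    exact
      { toIsDQGFeasibleSector := hs.toIsDQGFeasibleSector
        t1_psd := hT.t1_psd
        t2Prime_psd := hT.t2Prime_psd
        exchange_sum := hs.exchange_sum }

/-- **`E_PQG(N = 2n, S = 0)` over the `N`-programme with one row.** The optimal value of the printed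
singlet programme is the infimum of `Re E(γ, Γ)` over the DQG-feasible pairs at `N = 2n` satisfying the
spin-free row — a formulation with no `S_z` bookkeeping (FORMAT-qcl1 §9: "statement = N-sector"). -/
theorem pqgSingletEnergy_eq_sInf_spinFreeRow (h : Λ → Λ → ℂ) (g : Λ → Λ → Λ → Λ → ℂ) (hnuc : ℂ)
    (n : ℕ) :
    pqgSingletEnergy h g hnuc n =
      sInf {E : ℝ | ∃ γ Γ, IsDQGFeasible (n + n) γ Γ ∧
        ∑ σ : Fin 2, ∑ τ : Fin 2, ∑ p : Λ, ∑ q : Λ, Γ (orb p σ, orb q τ) (orb q σ, orb p τ) =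
          2 * (n : ℂ) * (2 - (n : ℂ)) ∧
        E = (rdmEnergy h g hnuc γ Γ).re} := by
  simp only [pqgSingletEnergy, isDQGFeasibleSinglet_iff_spinFreeRow, and_assoc]

/-- **THE SINGLET LOWER BOUND in spin-free form.** For `n ≤ |Λ|`: if `c` lies below the energy
functional on every DQG-feasible pair at `N = 2n` satisfying the one spin-free row, then
`c ≤ E₀(Ĥ; N = 2n, S = 0)`, the lowest energy of `Ĥ` on `(n,n)-sector ⊓ ker Ŝ_+` (the typer's
`le_minEnergyOn_singlet_of_forall_isDQGFeasibleSinglet`, hypothesis restated by §4). -/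
theorem le_minEnergyOn_singlet_of_forall_spinFreeRow (h : Λ → Λ → ℂ) (g : Λ → Λ → Λ → Λ → ℂ)
    (hnuc : ℂ) {n : ℕ} (hn : n ≤ Fintype.card Λ) {c : ℝ}
    (hc : ∀ γ Γ, IsDQGFeasible (n + n) γ Γ →
      ∑ σ : Fin 2, ∑ τ : Fin 2, ∑ p : Λ, ∑ q : Λ, Γ (orb p σ, orb q τ) (orb q σ, orb p τ) =
        2 * (n : ℂ) * (2 - (n : ℂ)) →
      c ≤ (rdmEnergy h g hnuc γ Γ).re) :
    c ≤ (molecularHamiltonian h g hnuc).minEnergyOn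
      (szSector (n + n) (((n : ℝ) - n) / 2) ⊓ LinearMap.ker (Matrix.toLin'
        (spinPlus : Matrix (Finset (Orb Λ)) (Finset (Orb Λ)) ℂ))) :=
  le_minEnergyOn_singlet_of_forall_isDQGFeasibleSinglet h g hnuc hn fun γ Γ hf =>
    hc γ Γ hf.dqg (exchangeTrace_of_isDQGFeasibleSinglet hf)

end Summit.Ventures.CertifiedQuantumChemistry

end
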